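import Summits.FinalStateConjecture.FinalStateConjecture.Theorems.EIHFluxBalanceInertialRecessionRechartKO
import Summits.FinalStateConjecture.FinalStateConjecture.Theorems.EIHFluxBalanceInertialRecessionRechartCausalKit
import Summits.FinalStateConjecture.FinalStateConjecture.Statement
import Summits.FinalStateConjecture.FinalStateConjecture.Theorems.EIHFluxBalanceInertialRecessionGrowingRadius

/-!
# Route EIHFluxBalance — `InertialRecession`, re-charting: assembling the re-charted
# `FinalStateDecomposition` (core)

Helper file for the crux `stmt-FinalStateConjecture-10166`
(`Summit.FinalStateConjecture.FinalStateConjecture.Theses.EIHFluxBalance.InertialRecession`),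
stub `stub_rechart` (the transfer P2 of line `sublinear-is-free-clean-window-charges`).

Given, on a Cauchy development `𝒟`, the lab chart `Φ : U → 𝒟` of the crux antecedent with its
exterior region `O = J⁺(ι X) ∩ I⁻(Φ(E))` and exhaustion clause, a family of re-charted `a = 0`
hole charts `ψᵢ = Φ ∘ Aᵢ` on the boosted Schwarzschild exteriors of the final motions
`(boost Vᵢ, 0)` with their analytic properties (open embeddings, near-zone `C²` convergence for
every fixed radius and along certified radii `Rᵢ`, eventual pairwise disjointness), a flat domain
`U₀ ⊆ U` with its package (tube containment, `C²` flat convergence, open embedding), and the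
TRANSFER statement (file `…RechartTransfer`: every point of `O` is certified-late after chart time
`τ₁` or in `J⁻` of the certified slab, for every `τ₁ ≥ τ₀′`), this file assembles the
`FinalStateDecomposition 𝒟 O′ 2` with `O′ := J⁺(ι X) ∩ I⁻(charted′)` and proves
`HasExhaustiveCharts` and the sub-extremality of the holes
(`exists_finalStateDecomposition_of_rechart`). Pure bookkeeping: openness of the charted region
(open embeddings) gives `charted′ ⊆ I⁻(charted′)`; `O′ ⊆ O` transports the transfer.

Revision 2026-08-16: the summit re-typing of 2026-08-16 (semantic-vacuity audit, §2.1 (B))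
strengthened `Summit.FinalStateConjecture.HasExhaustiveCharts` by the honest-radii clause
(`Rᵢ(τ) → ∞` and `max (r₊ᵢ) 0 + 1 ≤ Rᵢ(τ)`). The statement below is UNCHANGED (old-style radii
`Rcᵢ`); the proof now witnesses the clause with `Rᵢ τ := max (max (Rcᵢ τ) (Rgᵢ τ)) (r₊ᵢ + 1)`, `Rgᵢ → ∞`
the diagonal radii of the fixed-radius convergence (`exists_growing_radius'`): the truncated
deviation at a `max` of radii is at most the sum, and the certified sets and `J⁻` are monotone in
the radii. [folklore]
-/

noncomputable section

set_option linter.dupNamespace false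

open scoped Topology ContDiff Manifold ENNReal
open Filter Set Topology Function TopologicalSpace Literature.Geometry.Lorentzian

namespace Summit.FinalStateConjecture.FinalStateConjecture.Theorems

section Core

/-- The late regions of the boosted Schwarzschild background are open (registered stub
`isOpen_lateRegion_boostedSchwarzschild` of the crux item). [folklore] -/
theorem isOpen_lateRegion_boostedSchwarzschild : open Literature.Geometry.Lorentzian in ∀ {V : E3} (hV : ‖V‖ < 1) (M τ : ℝ), IsOpen ((boostedKerrBackground (Lorentz.boost V hV) 0 M 0).lateRegion τ) :=
  fun hV M _ ↦ isOpen_lt continuous_const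
    ((continuous_kb_boosted_time hV M).comp continuous_subtype_val)

variable {X : Type} [TopologicalSpace X] [ChartedSpace E3 X] [IsManifold (𝓡 3) ∞ X]
  [ConnectedSpace X] {D : InitialDataSet (𝓡 3) X}

-- long bookkeeping proof
set_option maxHeartbeats 800000 in
/-- **Assembly of the re-charted decomposition (core).** See the module docstring. [folklore] -/
theorem exists_finalStateDecomposition_of_rechart (𝒟 : VacuumCauchyDevelopment D) {N : ℕ}
    (M : Fin N → ℝ) (hM : ∀ i, 0 < M i) (V : Fin N → E3) (hV1 : ∀ i, ‖V i‖ < 1)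
    (U : Opens E4) (Φ : U → 𝒟.carrier) (hΦ : ContMDiff 𝓘(ℝ, E4) (𝓡 4) ∞ Φ)
    (O : Set 𝒟.carrier) (Pext : U → Prop) {τ₀ τ₀' : ℝ} (hτ : τ₀ < τ₀')
    (hO : O = 𝒟.metric.causalFuture 𝒟.timeOrientation (range 𝒟.embed) ∩
      𝒟.metric.chronologicalPast 𝒟.timeOrientation (Φ '' {x : U | τ₀ < x.1 0 ∧ Pext x}))
    (himO : Φ '' {x : U | τ₀ < x.1 0 ∧ Pext x} ⊆ O)
    -- the hole charts
    (A : Fin N → E4 → E4) (hA : ∀ i, ContDiff ℝ ∞ (A i))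
    (hAU : ∀ i, ∀ x ∈ (boostedKerrBackground (Lorentz.boost (V i) (hV1 i)) 0 (M i) 0).domain,
      A i x ∈ U)
    (hAlate : ∀ (i : Fin N)
      (y : (boostedKerrBackground (Lorentz.boost (V i) (hV1 i)) 0 (M i) 0).domain),
      τ₀ < A i y.1 0 ∧ Pext ⟨A i y.1, hAU i y.1 y.2⟩)
    (hψemb : ∀ i, IsOpenEmbedding
      (fun y : (boostedKerrBackground (Lorentz.boost (V i) (hV1 i)) 0 (M i) 0).domain ↦
        Φ ⟨A i y.1, hAU i y.1 y.2⟩))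
    (hconvR : ∀ (i : Fin N) (Rr : ℝ), Tendsto (fun τ ↦ 𝒟.toSpacetime.truncDeviationCk
      (boostedKerrBackground (Lorentz.boost (V i) (hV1 i)) 0 (M i) 0)
      (fun y ↦ Φ ⟨A i y.1, hAU i y.1 y.2⟩) 2 Rr τ) atTop (𝓝 0))
    (Rc : Fin N → ℝ → ℝ)
    (hRc : ∀ i, Tendsto (fun τ ↦ 𝒟.toSpacetime.truncDeviationCk
      (boostedKerrBackground (Lorentz.boost (V i) (hV1 i)) 0 (M i) 0)
      (fun y ↦ Φ ⟨A i y.1, hAU i y.1 y.2⟩) 2 (Rc i τ) τ) atTop (𝓝 0))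
    (hdisj : ∀ Rr : ℝ, ∃ τ₁ : ℝ, Pairwise (Function.onFun Disjoint fun i ↦
      (fun y : (boostedKerrBackground (Lorentz.boost (V i) (hV1 i)) 0 (M i) 0).domain ↦
        Φ ⟨A i y.1, hAU i y.1 y.2⟩) ''
        (boostedKerrBackground (Lorentz.boost (V i) (hV1 i)) 0 (M i) 0).truncLateRegion τ₁ Rr))
    -- the flat chart
    (U₀ : Opens E4) (hU₀ : U₀ ≤ U) (ρexc : Fin N → ℝ → ℝ)
    (hexc : ∀ i, Tendsto (fun t ↦ ρexc i t / t) atTop (𝓝 0))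
    (htube : {x : E4 | τ₀' < x 0 ∧ ∀ i, ρexc i (x 0) <
      Kerr.radius 0 (poincareInv (Lorentz.boost (V i) (hV1 i)) 0 x)} ⊆ (U₀ : Set E4))
    (hflatdev : Tendsto (fun t ↦ 𝒟.toSpacetime.deviationCk (Minkowski.backgroundOn U₀)
      (Φ ∘ Opens.inclusion hU₀) 2 t) atTop (𝓝 0))
    (hflatemb : IsOpenEmbedding
      (((Minkowski.backgroundOn U₀).lateRegion τ₀').restrict (Φ ∘ Opens.inclusion hU₀)))
    (hU₀E : ∀ x : U₀, τ₀' < x.1 0 → Pext (Opens.inclusion hU₀ x))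
    -- the transfer (file `…RechartTransfer`)
    (htransfer : ∀ τ₁ : ℝ, τ₀' ≤ τ₁ →
      O ⊆ ((Φ ∘ Opens.inclusion hU₀) '' {x : U₀ | τ₁ < x.1 0} ∪
          ⋃ i, (fun y : (boostedKerrBackground (Lorentz.boost (V i) (hV1 i)) 0 (M i) 0).domain ↦
            Φ ⟨A i y.1, hAU i y.1 y.2⟩) ''
            {y | τ₁ < (boostedKerrBackground (Lorentz.boost (V i) (hV1 i)) 0 (M i) 0).time y.1 ∧
              (boostedKerrBackground (Lorentz.boost (V i) (hV1 i)) 0 (M i) 0).radius y.1 ≤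
                Rc i ((boostedKerrBackground (Lorentz.boost (V i) (hV1 i)) 0 (M i) 0).time y.1)}) ∪
        𝒟.metric.causalPast 𝒟.timeOrientation
          ((Φ ∘ Opens.inclusion hU₀) '' {x : U₀ | x.1 0 = τ₁} ∪
            ⋃ i, (fun y : (boostedKerrBackground (Lorentz.boost (V i) (hV1 i)) 0 (M i) 0).domain ↦
              Φ ⟨A i y.1, hAU i y.1 y.2⟩) ''
              (boostedKerrBackground (Lorentz.boost (V i) (hV1 i)) 0 (M i) 0).truncTimeSlab
                (Rc i τ₁) τ₁)) :
    ∃ (O' : Set 𝒟.carrier) (d : FinalStateDecomposition 𝒟.toSpacetime O' 2),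
      (∀ i, Kerr.IsSubextremal (d.mass i) (d.spin i)) ∧
        O' = Summit.FinalStateConjecture.exteriorOf 𝒟.toCauchyDevelopment d.charted ∧
          Summit.FinalStateConjecture.HasExhaustiveCharts d := by
  -- notation
  set Kb : Fin N → ModelBackground := fun i ↦
    boostedKerrBackground (Lorentz.boost (V i) (hV1 i)) 0 (M i) 0 with hKb
  set ψ : ∀ i, (Kb i).domain → 𝒟.carrier := fun i y ↦ Φ ⟨A i y.1, hAU i y.1 y.2⟩ with hψ
  set E : Set U := {x : U | τ₀ < x.1 0 ∧ Pext x} with hE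
  -- honest growing radii (re-typed `HasExhaustiveCharts`): diagonal radii of the fixed-radius
  -- convergence, `max`ed with `Rc` and the floor `r₊ + 1`
  have hg : ∀ i, ∃ Rg : ℝ → ℝ, Tendsto Rg atTop atTop ∧
      Tendsto (fun τ ↦ 𝒟.toSpacetime.truncDeviationCk (Kb i) (ψ i) 2 (Rg τ) τ) atTop (𝓝 0) := fun i ↦ by
    obtain ⟨Rg, -, hRt, hRc'⟩ := exists_growing_radius'
      (f := fun τ r ↦ 𝒟.toSpacetime.truncDeviationCk (Kb i) (ψ i) 2 r τ) fun n ↦ hconvR i n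
    exact ⟨Rg, hRt, hRc'⟩
  choose Rg hRgt hRgc using hg
  set R : Fin N → ℝ → ℝ := fun i τ ↦ max (max (Rc i τ) (Rg i τ)) (Kerr.rPlus (M i) 0 + 1) with hR
  have hRcR : ∀ i τ, Rc i τ ≤ R i τ := fun i τ ↦ (le_max_left _ _).trans (le_max_left _ _)
  have hrp : ∀ i, 0 < Kerr.rPlus (M i) 0 := fun i ↦ by
    rw [Kerr.rPlus_zero_right (hM i).le]; linarith [hM i]
  have hR1 : ∀ i τ, max (Kerr.rPlus (M i) 0) 0 + 1 ≤ R i τ := fun i τ ↦ by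
    rw [max_eq_left (hrp i).le]
    exact le_max_right _ _
  have hRt : ∀ i, Tendsto (R i) atTop atTop := fun i ↦
    tendsto_atTop_mono (fun τ ↦ (le_max_right _ _).trans (le_max_left _ _)) (hRgt i)
  have hmaxle : ∀ (i : Fin N) (R₁ R₂ τ : ℝ), 𝒟.toSpacetime.truncDeviationCk (Kb i) (ψ i) 2 (max R₁ R₂) τ ≤
      𝒟.toSpacetime.truncDeviationCk (Kb i) (ψ i) 2 R₁ τ +
        𝒟.toSpacetime.truncDeviationCk (Kb i) (ψ i) 2 R₂ τ := fun i R₁ R₂ τ ↦ by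
    rcases le_total R₁ R₂ with h | h
    · rw [max_eq_right h]; exact le_add_self
    · rw [max_eq_left h]; exact le_self_add
  have hRconv : ∀ i, Tendsto (fun τ ↦ 𝒟.toSpacetime.truncDeviationCk (Kb i) (ψ i) 2 (R i τ) τ)
      atTop (𝓝 0) := fun i ↦ by
    have h12 : Tendsto (fun τ ↦ 𝒟.toSpacetime.truncDeviationCk (Kb i) (ψ i) 2
        (max (Rc i τ) (Rg i τ)) τ) atTop (𝓝 0) :=
      tendsto_of_tendsto_of_tendsto_of_le_of_le tendsto_const_nhds (by simpa using (hRc i).add (hRgc i))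
        (fun _ ↦ zero_le) fun τ ↦ hmaxle i _ _ τ
    exact tendsto_of_tendsto_of_tendsto_of_le_of_le tendsto_const_nhds
      (by simpa using h12.add (hconvR i (Kerr.rPlus (M i) 0 + 1))) (fun _ ↦ zero_le) fun τ ↦ hmaxle i _ _ τ
  -- the transfer is monotone in the radii
  have htransfer' : ∀ τ₁ : ℝ, τ₀' ≤ τ₁ →
      O ⊆ ((Φ ∘ Opens.inclusion hU₀) '' {x : U₀ | τ₁ < x.1 0} ∪
          ⋃ i, ψ i '' {y | τ₁ < (Kb i).time y.1 ∧ (Kb i).radius y.1 ≤ R i ((Kb i).time y.1)}) ∪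
        𝒟.metric.causalPast 𝒟.timeOrientation
          ((Φ ∘ Opens.inclusion hU₀) '' {x : U₀ | x.1 0 = τ₁} ∪
            ⋃ i, ψ i '' (Kb i).truncTimeSlab (R i τ₁) τ₁) := by
    intro τ₁ hτ₁ p hp
    rcases htransfer τ₁ hτ₁ hp with (hl | hl) | hJ
    · exact Or.inl (Or.inl hl)
    · obtain ⟨i, y, ⟨hy1, hy2⟩, rfl⟩ := mem_iUnion.mp hl
      exact Or.inl (Or.inr (mem_iUnion.mpr ⟨i, y, ⟨hy1, hy2.trans (hRcR i _)⟩, rfl⟩))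
    · refine Or.inr (LorentzianMetric.causalFuture_mono ?_ hJ)
      refine union_subset_union le_rfl (iUnion_mono fun i ↦ image_mono ?_)
      exact (Kb i).truncTimeSlab_mono (hRcR i τ₁) τ₁
  set C' : Set 𝒟.carrier := (Φ ∘ Opens.inclusion hU₀) '' (Minkowski.backgroundOn U₀).lateRegion τ₀' ∪
    ⋃ i, ψ i '' (Kb i).lateRegion τ₀' with hC'
  set O' : Set 𝒟.carrier := Summit.FinalStateConjecture.exteriorOf 𝒟.toCauchyDevelopment C'
    with hO'
  -- `C' ⊆ Φ(E)`, hence `O' ⊆ O`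
  have hC'E : C' ⊆ Φ '' E := by
    rintro p (⟨x, hx, rfl⟩ | hp)
    · exact ⟨Opens.inclusion hU₀ x, ⟨hτ.trans hx, hU₀E x hx⟩, rfl⟩
    · obtain ⟨i, y, -, rfl⟩ := mem_iUnion.mp hp
      exact ⟨⟨A i y.1, hAU i y.1 y.2⟩, hAlate i y, rfl⟩
  have hO'O : O' ⊆ O := by
    rw [hO]
    exact inter_subset_inter_right _ (LorentzianMetric.chronologicalFuture_mono hC'E)
  have hOJ : O ⊆ 𝒟.metric.causalFuture 𝒟.timeOrientation (range 𝒟.embed) := by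
    rw [hO]; exact inter_subset_left
  -- `C'` is open
  have hlateo : ∀ (i) (τ : ℝ), IsOpen ((Kb i).lateRegion τ) := fun i τ ↦
    isOpen_lateRegion_boostedSchwarzschild (hV1 i) (M i) τ
  have hC'o : IsOpen C' := by
    refine IsOpen.union ?_ (isOpen_iUnion fun i ↦ (hψemb i).isOpenMap _ (hlateo i τ₀'))
    rw [← range_restrict]
    exact hflatemb.isOpen_range
  -- every part of `C'` lies in `O'`
  have hpartO' : ∀ S : Set 𝒟.carrier, S ⊆ C' → S ⊆ O' := fun S hS ↦
    subset_inter (hS.trans (hC'E.trans (himO.trans hOJ)))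
      (subset_chronologicalPast_of_subset_isOpen hC'o hS)
  have hholeO' : ∀ i, ψ i '' (Kb i).lateRegion τ₀' ⊆ O' := fun i ↦
    hpartO' _ ((subset_iUnion (fun i ↦ ψ i '' (Kb i).lateRegion τ₀') i).trans subset_union_right)
  have hflatO' : (Φ ∘ Opens.inclusion hU₀) '' (Minkowski.backgroundOn U₀).lateRegion τ₀' ⊆ O' :=
    hpartO' _ subset_union_left
  -- the decomposition
  let d : FinalStateDecomposition 𝒟.toSpacetime O' 2 :=
    { N := N
      mass := M
      spin := fun _ ↦ 0
      mass_pos := hM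
      abs_spin_le_mass := fun i ↦ by rw [abs_zero]; exact (hM i).le
      motion := fun i ↦ (Lorentz.boost (V i) (hV1 i), 0)
      τ₀ := τ₀'
      chart := fun i ↦ ψ i
      isLateChart := fun i ↦ ⟨contMDiff_comp_smooth (hA i) (hAU i) (fun _ ↦ rfl) hΦ,
        (hψemb i).comp (hlateo i τ₀').isOpenEmbedding_subtypeVal, hholeO' i⟩
      tendsto_truncDeviationCk := fun i Rr ↦ hconvR i Rr
      exists_pairwise_disjoint := hdisj
      excision := ρexc
      tendsto_excision_div := hexc
      flatDomain := U₀
      setOf_lt_excision_subset_flatDomain := htube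
      flatChart := Φ ∘ Opens.inclusion hU₀
      isLateChart_flat := ⟨hΦ.comp (contMDiff_inclusion hU₀), hflatemb, hflatO'⟩
      tendsto_deviationCk_flat := hflatdev
      diff_subset_causalPast := by
        intro p hp
        rcases htransfer τ₀' le_rfl (hO'O hp.1) with hl | hJ
        · -- certified-late points are charted-late
          exfalso
          refine hp.2 ?_
          rcases hl with ⟨x, hx, rfl⟩ | hl
          · exact Or.inr ⟨x, hx, rfl⟩
          · obtain ⟨i, y, ⟨hy1, -⟩, rfl⟩ := mem_iUnion.mp hl
            exact Or.inl (mem_iUnion.mpr ⟨i, y, hy1, rfl⟩)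
        · refine LorentzianMetric.causalFuture_mono ?_ hJ
          rintro q (⟨x, hx, rfl⟩ | hq)
          · exact Or.inr ⟨x, hx, rfl⟩
          · obtain ⟨i, y, hy, rfl⟩ := mem_iUnion.mp hq
            exact Or.inl (mem_iUnion.mpr ⟨i, y, hy.1, rfl⟩) }
  refine ⟨O', d, fun i ↦ ?_, ?_, ⟨R, fun i ↦ ⟨hRt i, hR1 i⟩, hRconv, fun τ₁ hτ₁ ↦ ?_⟩⟩
  · -- sub-extremal: `|0| < Mᵢ`
    show |(0 : ℝ)| < M i
    rw [abs_zero]; exact hM i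
  · -- `O' = J⁺(ι X) ∩ I⁻(d.charted)`: `d.charted = C'`
    have hch : d.charted = C' := by
      show (Φ ∘ Opens.inclusion hU₀) '' (Minkowski.backgroundOn U₀).lateRegion τ₀' ∪
        ⋃ i, ψ i '' (Kb i).lateRegion τ₀' = C'
      rfl
    rw [hch]
  · -- exhaustion at chart time `τ₁ > τ₀'`
    intro p hp
    have hτ₁' : τ₀' ≤ τ₁ := le_of_lt hτ₁
    rcases htransfer' τ₁ hτ₁' (hO'O hp.1) with hl | hJ
    · exact absurd hl hp.2
    · exact hJ

end Core

end Summit.FinalStateConjecture.FinalStateConjecture.Theorems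

end
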